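import Mathlib
import Summits.Ventures.PercRepro2.CoinChainXASixCellGen

/-!
# The polynomial certificate of (XA′) for the gate `d' = d·1[j ∈ W]` on the six-cell sub-case
(blind cell PercRepro2, night-2 g27; proofs/NIGHT2-DARC.md §68.13)

46 products with integer coefficients of 13 set-level Ahlswede–Daykin slacks on unions of cells, the cellwise
order slacks `d ≤ c` and monomials sum to the cleared (XA′) functional `a0·U001 − Cross` with the moments of the gate
`d' = d·1[j ∈ W]` (`xa_six_gateJGen_ET`, pure algebra), each product is nonnegative under the facts
(`xa_six_gateJGen_S`), hence the functional is (`xa_six_gateJGen_cert`).  Found by LP (kit j307364), rationalised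
exactly in Fractions (all coefficients integers).  The bridge to the chain data is in CoinChainXASixGateJGen.lean.
-/

namespace Summit.Ventures.PercRepro2.Coin

open Classical

section SixGateCert

variable {R : Type*} [Field R] [LinearOrder R] [IsStrictOrderedRing R]

omit [LinearOrder R] [IsStrictOrderedRing R] in
set_option maxHeartbeats 1600000 in
/-- The cleared (XA′) functional with the gate `d' = d·1[j ∈ W]` as the positive combination of the 46 products (pure algebra). -/
lemma xa_six_gateJGen_ET (o a₀ a₁ b _r₀ r₁ ou a₀u a₁u bu r₀u r₁u : R) :
    ((o + a₀ + a₁ + bu + r₀u + r₁u) * ((o + a₀ + a₁ + bu + r₀u + r₁u) * (o + a₀ + a₁ + bu + r₀u + r₁u) * (r₁u) - (o + a₀ + a₁ + bu + r₀u + r₁u) * (a₁ + r₁u) * (0 + 0 + r₁u) - (o + a₀ + a₁ + bu + r₀u + r₁u) * (bu + r₀u + r₁u) * (a₁u + r₁u) + (bu + r₀u + r₁u) * (a₁ + r₁u) * (o + 0 + a₁u + 0 + 0 + r₁u))) - (((o + a₀ + a₁ + bu + r₀u + r₁u) * (bu + r₀u + r₁u) - (bu + r₀u + r₁u) * (o +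 a₀u + a₁u + bu + r₀u + r₁u)) * ((o + a₀ + a₁ + bu + r₀u + r₁u) * (a₁ + r₁u) - (a₁ + r₁u) * (o + a₀ + a₁ + 0 + 0 + r₁u))
    + ((o + a₀ + a₁ + bu + r₀u + r₁u) * (a₁u + r₁u) - (a₁ + r₁u) * (o + a₀u + a₁u + bu + r₀u + r₁u)) * ((o + a₀ + a₁ + bu + r₀u + r₁u) * (0 + 0 + r₁u) - (bu + r₀u + r₁u) * (o + a₀ + a₁ + 0 + 0 + r₁u))) = (((a₀ + (o)) * a₀ - a₀ * a₀) * (o * r₁u - a₁ * bu) * (1)) + (((a₀ + (o)) * a₀ - a₀ * a₀) * ((a₀ + (o)) * r₁u - a₁ * r₀u) * (1)) + (((a₀ + (o)) * a₀ - a₀ * a₀) * ((bu + (r₀u)) * r₁u - r₀u * r₁u) * (1)) + (((a₀ + (o)) * a₁ - a₀ * a₁) * ((a₀ + (o)) * r₁u - a₀ * r₁u) * (1)) + (2 : R) * (((a₀ + (o)) * a₁ - a₀ * a₁) * ((bu + (r₀u)) * r₁u - r₀u * r₁u) * (1)) + (2 : R) * (((a₀ + (o)) * r₀u - a₀ * r₀u)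 * ((a₀ + (o)) * r₁u - a₀ * r₁u) * (1)) + (2 : R) * (((a₀ + (o)) * r₁u - a₀ * r₁u) * ((a₀ + (o)) * r₁u - a₀ * r₁u) * (1)) + (((a₀ + (o)) * r₁u - a₀ * r₁u) * ((bu + (r₀u)) * r₁u - r₀u * r₁u) * (1)) + (2 : R) * (((a₀ + (o)) * a₀ - a₀ * a₀) * (r₁u ^ 2)) + (2 : R) * (((a₀ + (o)) * a₁ - a₀ * a₁) * (r₁u ^ 2)) + (((a₀ + (o)) * a₁ - a₀ * a₁) * (r₀u * r₁u)) + (((a₀ + (o)) * r₀u - a₀ * r₀u) * (r₁u ^ 2)) + (((a₀ + (o)) * r₁u - a₀ * r₁u) * (r₁u ^ 2)) + (2 : R) * (((a₀ + (o)) * r₁u - a₀ * r₁u) * (o * bu)) + (((a₀ + (o)) * r₁u - a₀ * r₁u) * (o ^ 2)) + ((o * r₁u - a₁ * bu) * (a₁ * r₀u)) + ((o * r₁u - a₁ * bu) * (a₁ * bu)) + (2 : R) * ((o * r₁u - a₁ * bu) * (a₀ * r₀u)) + ((o * r₁u - a₁ * bu) * (a₀ * bu)) + (((a₀ + (o)) *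 r₁u - a₁ * r₀u) * (a₀ * r₁u)) + (2 : R) * (((a₀ + (o)) * r₁u - a₁ * r₀u) * (a₀ * r₀u)) + (((a₀ + (o)) * r₁u - a₁ * (bu + (r₀u))) * (o * r₀u)) + (((a₀ + (o)) * r₁u - a₁ * (bu + (r₀u))) * (o * bu)) + (((a₀ + (o)) * r₁u - a₁ * (bu + (r₀u))) * (a₁ * r₀u)) + (((a₀ + (o)) * r₁u - a₁ * (bu + (r₀u))) * (a₁ * a₀u)) + (2 : R) * (((a₀ + (o)) * r₁u - a₁ * (bu + (r₀u))) * (a₀ * bu)) + (((a₀ + (o)) * r₁u - a₁ * (bu + (r₀u))) * (a₀ ^ 2)) + (((a₀u + (ou)) * r₁u - a₁u * (bu + (r₀u))) * (r₀u * r₁u)) + (((a₀u + (ou)) * r₁u - a₁u * (bu + (r₀u))) * (r₀u ^ 2)) + (((a₀u + (ou)) * r₁u - a₁u * (bu + (r₀u))) * (bu * r₁u)) + (2 : R) * (((a₀u + (ou)) * r₁u - a₁u * (bu + (r₀u))) * (bu * r₀u)) + (((a₀u + (ou)) * r₁u - a₁u * (bu + (r₀u))) * (bu ^ 2)) + (((a₀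 + (a₁ + (o))) * (a₀ + (a₁ + (r₁ + (o)))) - (r₁ + (o)) * (a₀ + (a₁ + (o)))) * (o * r₁u)) + (((bu + (r₀u + (r₁u + (ou)))) * (bu + (r₀u + (r₁u))) - (r₁u + (ou)) * (bu + (r₀u + (r₁u)))) * (o * r₁u)) + (((a₀ + (o)) * r₁u - a₁ * r₀u) * (a₀ - a₀u) * (bu)) + (((a₀ + (o)) * r₁u - a₁ * (bu + (r₀u))) * (a₀ - a₀u) * (r₀u)) + (((a₀ + (o)) * r₁u - a₁ * (bu + (r₀u))) * (a₁ - a₁u) * (r₀u)) + (((a₀ + (o)) * r₁u - a₁ * (bu + (r₀u))) * (a₁ - a₁u) * (bu)) + (((a₀ + (a₁ + (b + (o)))) * (bu + (r₀u + (r₁u))) - (a₁ + (b)) * (bu + (r₀u + (r₁u)))) * (a₀ - a₀u) * (a₁)) + (((a₀ + (a₁ + (b + (o)))) * (bu + (r₀u + (r₁u))) - (a₁ + (b)) * (bu + (r₀u + (r₁u)))) * (a₁ - a₁u) * (r₁u)) + (((a₀ + (a₁ + (o))) * (a₁u + (r₀u + (r₁u))) - (a₁u + (r₀u)) * (a₀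 + (a₁ + (o)))) * (a₁ - a₁u) * (o)) + (((a₀ + (a₁ + (o))) * (a₁u + (r₀u + (r₁u))) - (a₁u + (r₀u)) * (a₀ + (a₁ + (o)))) * (a₁ - a₁u) * (a₀)) + (((bu + (r₀u + (r₁u + (ou)))) * (bu + (r₀u + (r₁u))) - (r₁u + (ou)) * (bu + (r₀u + (r₁u)))) * (a₁ - a₁u) * (o)) + (((bu + (r₀u + (r₁u + (ou)))) * (bu + (r₀u + (r₁u))) - (r₁u + (ou)) * (bu + (r₀u + (r₁u)))) * (a₁ - a₁u) * (a₀)) + (((bu + (r₀u + (r₁u + (ou)))) * (bu + (r₀u + (r₁u))) - (r₁u + (ou)) * (bu + (r₀u + (r₁u)))) * (o - ou) * (r₁u)) + (a₁ * a₀u * (bu ^ 2)) := by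
  ring

set_option maxHeartbeats 1600000 in
/-- The 46 products of the certificate are nonnegative (given the set-level facts). -/
lemma xa_six_gateJGen_S (o a₀ a₁ b r₀ r₁ ou a₀u a₁u bu r₀u r₁u : R)
    (ho : 0 ≤ o) (ha₀ : 0 ≤ a₀) (ha₁ : 0 ≤ a₁) (_hb : 0 ≤ b) (_hr₀ : 0 ≤ r₀) (_hr₁ : 0 ≤ r₁) (_hou : 0 ≤ ou) (ha₀u : 0 ≤ a₀u) (_ha₁u : 0 ≤ a₁u) (hbu : 0 ≤ bu) (hr₀u : 0 ≤ r₀u) (hr₁u : 0 ≤ r₁u)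
    (hord_Dp00 : a₀u ≤ a₀) (hord_Dp01 : a₁u ≤ a₁) (_hord_Dpp10 : bu ≤ b) (_hord_Dst10 : r₀u ≤ r₀) (_hord_Dst11 : r₁u ≤ r₁) (hord_I0 : ou ≤ o)
    (f0 : a₀ * a₀ ≤ (a₀ + (o)) * a₀)
    (f1 : a₁ * bu ≤ o * r₁u)
    (f2 : a₁ * r₀u ≤ (a₀ + (o)) * r₁u)
    (f3 : r₀u * r₁u ≤ (bu + (r₀u)) * r₁u)
    (f4 : a₀ * a₁ ≤ (a₀ + (o)) * a₁)
    (f5 : a₀ * r₁u ≤ (a₀ + (o)) * r₁u)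
    (f6 : a₀ * r₀u ≤ (a₀ + (o)) * r₀u)
    (f7 : a₁ * (bu + (r₀u)) ≤ (a₀ + (o)) * r₁u)
    (f8 : a₁u * (bu + (r₀u)) ≤ (a₀u + (ou)) * r₁u)
    (f9 : (r₁ + (o)) * (a₀ + (a₁ + (o))) ≤ (a₀ + (a₁ + (o))) * (a₀ + (a₁ + (r₁ + (o)))))
    (f10 : (r₁u + (ou)) * (bu + (r₀u + (r₁u))) ≤ (bu + (r₀u + (r₁u + (ou)))) * (bu + (r₀u + (r₁u))))
    (f11 : (a₁ + (b)) * (bu + (r₀u + (r₁u))) ≤ (a₀ + (a₁ + (b + (o)))) * (bu + (r₀u + (r₁u))))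
    (f12 : (a₁u + (r₀u)) * (a₀ + (a₁ + (o))) ≤ (a₀ + (a₁ + (o))) * (a₁u + (r₀u + (r₁u)))) :
    0 ≤ (((a₀ + (o)) * a₀ - a₀ * a₀) * (o * r₁u - a₁ * bu) * (1)) + (((a₀ + (o)) * a₀ - a₀ * a₀) * ((a₀ + (o)) * r₁u - a₁ * r₀u) * (1)) + (((a₀ + (o)) * a₀ - a₀ * a₀) * ((bu + (r₀u)) * r₁u - r₀u * r₁u) * (1)) + (((a₀ + (o)) * a₁ - a₀ * a₁) * ((a₀ + (o)) * r₁u - a₀ * r₁u) * (1)) + (2 : R) * (((a₀ + (o)) * a₁ - a₀ * a₁) * ((bu + (r₀u)) * r₁u - r₀u * r₁u) * (1)) + (2 : R) * (((a₀ + (o)) * r₀u - a₀ * r₀u) * ((a₀ + (o)) * r₁u - a₀ * r₁u) * (1)) + (2 : R) * (((a₀ + (o)) * r₁u - a₀ * r₁u) * ((a₀ + (o)) * r₁u - a₀ * r₁u) * (1)) + (((a₀ + (o)) * r₁u - a₀ * r₁u) * ((bu + (r₀u)) * r₁u - r₀u * r₁u) * (1)) + (2 : R) * (((a₀ + (o))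 * a₀ - a₀ * a₀) * (r₁u ^ 2)) + (2 : R) * (((a₀ + (o)) * a₁ - a₀ * a₁) * (r₁u ^ 2)) + (((a₀ + (o)) * a₁ - a₀ * a₁) * (r₀u * r₁u)) + (((a₀ + (o)) * r₀u - a₀ * r₀u) * (r₁u ^ 2)) + (((a₀ + (o)) * r₁u - a₀ * r₁u) * (r₁u ^ 2)) + (2 : R) * (((a₀ + (o)) * r₁u - a₀ * r₁u) * (o * bu)) + (((a₀ + (o)) * r₁u - a₀ * r₁u) * (o ^ 2)) + ((o * r₁u - a₁ * bu) * (a₁ * r₀u)) + ((o * r₁u - a₁ * bu) * (a₁ * bu)) + (2 : R) * ((o * r₁u - a₁ * bu) * (a₀ * r₀u)) + ((o * r₁u - a₁ * bu) * (a₀ * bu)) + (((a₀ + (o)) * r₁u - a₁ * r₀u) * (a₀ * r₁u)) + (2 : R) * (((a₀ + (o)) * r₁u - a₁ * r₀u) * (a₀ * r₀u)) + (((a₀ + (o)) * r₁u - a₁ * (bu + (r₀u))) * (o * r₀u)) + (((a₀ + (o)) * r₁u - a₁ * (bu + (r₀u))) * (o * bu)) + (((a₀ + (o)) * r₁u - a₁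 * (bu + (r₀u))) * (a₁ * r₀u)) + (((a₀ + (o)) * r₁u - a₁ * (bu + (r₀u))) * (a₁ * a₀u)) + (2 : R) * (((a₀ + (o)) * r₁u - a₁ * (bu + (r₀u))) * (a₀ * bu)) + (((a₀ + (o)) * r₁u - a₁ * (bu + (r₀u))) * (a₀ ^ 2)) + (((a₀u + (ou)) * r₁u - a₁u * (bu + (r₀u))) * (r₀u * r₁u)) + (((a₀u + (ou)) * r₁u - a₁u * (bu + (r₀u))) * (r₀u ^ 2)) + (((a₀u + (ou)) * r₁u - a₁u * (bu + (r₀u))) * (bu * r₁u)) + (2 : R) * (((a₀u + (ou)) * r₁u - a₁u * (bu + (r₀u))) * (bu * r₀u)) + (((a₀u + (ou)) * r₁u - a₁u * (bu + (r₀u))) * (bu ^ 2)) + (((a₀ + (a₁ + (o))) * (a₀ + (a₁ + (r₁ + (o)))) - (r₁ + (o)) * (a₀ + (a₁ + (o)))) * (o * r₁u)) + (((bu + (r₀u + (r₁u + (ou)))) * (bu + (r₀u + (r₁u))) - (r₁u + (ou)) * (bu + (r₀u + (r₁u)))) * (o * r₁u)) + (((a₀ + (o)) * r₁u - a₁ *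 r₀u) * (a₀ - a₀u) * (bu)) + (((a₀ + (o)) * r₁u - a₁ * (bu + (r₀u))) * (a₀ - a₀u) * (r₀u)) + (((a₀ + (o)) * r₁u - a₁ * (bu + (r₀u))) * (a₁ - a₁u) * (r₀u)) + (((a₀ + (o)) * r₁u - a₁ * (bu + (r₀u))) * (a₁ - a₁u) * (bu)) + (((a₀ + (a₁ + (b + (o)))) * (bu + (r₀u + (r₁u))) - (a₁ + (b)) * (bu + (r₀u + (r₁u)))) * (a₀ - a₀u) * (a₁)) + (((a₀ + (a₁ + (b + (o)))) * (bu + (r₀u + (r₁u))) - (a₁ + (b)) * (bu + (r₀u + (r₁u)))) * (a₁ - a₁u) * (r₁u)) + (((a₀ + (a₁ + (o))) * (a₁u + (r₀u + (r₁u))) - (a₁u + (r₀u)) * (a₀ + (a₁ + (o)))) * (a₁ - a₁u) * (o)) + (((a₀ + (a₁ + (o))) * (a₁u + (r₀u + (r₁u))) - (a₁u + (r₀u)) * (a₀ + (a₁ + (o)))) * (a₁ - a₁u) * (a₀)) + (((bu + (r₀u + (r₁u + (ou)))) * (bu + (r₀u + (r₁u))) - (r₁u + (ou)) * (bu + (r₀u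 + (r₁u)))) * (a₁ - a₁u) * (o)) + (((bu + (r₀u + (r₁u + (ou)))) * (bu + (r₀u + (r₁u))) - (r₁u + (ou)) * (bu + (r₀u + (r₁u)))) * (a₁ - a₁u) * (a₀)) + (((bu + (r₀u + (r₁u + (ou)))) * (bu + (r₀u + (r₁u))) - (r₁u + (ou)) * (bu + (r₀u + (r₁u)))) * (o - ou) * (r₁u)) + (a₁ * a₀u * (bu ^ 2)) := by
  have H0 := mul_nonneg (mul_nonneg (sub_nonneg.2 f0) (sub_nonneg.2 f1)) (by positivity : (0:R) ≤ 1)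
  have H1 := mul_nonneg (mul_nonneg (sub_nonneg.2 f0) (sub_nonneg.2 f2)) (by positivity : (0:R) ≤ 1)
  have H2 := mul_nonneg (mul_nonneg (sub_nonneg.2 f0) (sub_nonneg.2 f3)) (by positivity : (0:R) ≤ 1)
  have H3 := mul_nonneg (mul_nonneg (sub_nonneg.2 f4) (sub_nonneg.2 f5)) (by positivity : (0:R) ≤ 1)
  have H4 := mul_nonneg (mul_nonneg (sub_nonneg.2 f4) (sub_nonneg.2 f3)) (by positivity : (0:R) ≤ 1)
  have H5 := mul_nonneg (mul_nonneg (sub_nonneg.2 f6) (sub_nonneg.2 f5)) (by positivity : (0:R) ≤ 1)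
  have H6 := mul_nonneg (mul_nonneg (sub_nonneg.2 f5) (sub_nonneg.2 f5)) (by positivity : (0:R) ≤ 1)
  have H7 := mul_nonneg (mul_nonneg (sub_nonneg.2 f5) (sub_nonneg.2 f3)) (by positivity : (0:R) ≤ 1)
  have H8 := mul_nonneg (sub_nonneg.2 f0) (by positivity : (0:R) ≤ r₁u ^ 2)
  have H9 := mul_nonneg (sub_nonneg.2 f4) (by positivity : (0:R) ≤ r₁u ^ 2)
  have H10 := mul_nonneg (sub_nonneg.2 f4) (by positivity : (0:R) ≤ r₀u * r₁u)
  have H11 := mul_nonneg (sub_nonneg.2 f6) (by positivity : (0:R) ≤ r₁u ^ 2)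
  have H12 := mul_nonneg (sub_nonneg.2 f5) (by positivity : (0:R) ≤ r₁u ^ 2)
  have H13 := mul_nonneg (sub_nonneg.2 f5) (by positivity : (0:R) ≤ o * bu)
  have H14 := mul_nonneg (sub_nonneg.2 f5) (by positivity : (0:R) ≤ o ^ 2)
  have H15 := mul_nonneg (sub_nonneg.2 f1) (by positivity : (0:R) ≤ a₁ * r₀u)
  have H16 := mul_nonneg (sub_nonneg.2 f1) (by positivity : (0:R) ≤ a₁ * bu)
  have H17 := mul_nonneg (sub_nonneg.2 f1) (by positivity : (0:R) ≤ a₀ * r₀u)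
  have H18 := mul_nonneg (sub_nonneg.2 f1) (by positivity : (0:R) ≤ a₀ * bu)
  have H19 := mul_nonneg (sub_nonneg.2 f2) (by positivity : (0:R) ≤ a₀ * r₁u)
  have H20 := mul_nonneg (sub_nonneg.2 f2) (by positivity : (0:R) ≤ a₀ * r₀u)
  have H21 := mul_nonneg (sub_nonneg.2 f7) (by positivity : (0:R) ≤ o * r₀u)
  have H22 := mul_nonneg (sub_nonneg.2 f7) (by positivity : (0:R) ≤ o * bu)
  have H23 := mul_nonneg (sub_nonneg.2 f7) (by positivity : (0:R) ≤ a₁ * r₀u)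
  have H24 := mul_nonneg (sub_nonneg.2 f7) (by positivity : (0:R) ≤ a₁ * a₀u)
  have H25 := mul_nonneg (sub_nonneg.2 f7) (by positivity : (0:R) ≤ a₀ * bu)
  have H26 := mul_nonneg (sub_nonneg.2 f7) (by positivity : (0:R) ≤ a₀ ^ 2)
  have H27 := mul_nonneg (sub_nonneg.2 f8) (by positivity : (0:R) ≤ r₀u * r₁u)
  have H28 := mul_nonneg (sub_nonneg.2 f8) (by positivity : (0:R) ≤ r₀u ^ 2)
  have H29 := mul_nonneg (sub_nonneg.2 f8) (by positivity : (0:R) ≤ bu * r₁u)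
  have H30 := mul_nonneg (sub_nonneg.2 f8) (by positivity : (0:R) ≤ bu * r₀u)
  have H31 := mul_nonneg (sub_nonneg.2 f8) (by positivity : (0:R) ≤ bu ^ 2)
  have H32 := mul_nonneg (sub_nonneg.2 f9) (by positivity : (0:R) ≤ o * r₁u)
  have H33 := mul_nonneg (sub_nonneg.2 f10) (by positivity : (0:R) ≤ o * r₁u)
  have H34 := mul_nonneg (mul_nonneg (sub_nonneg.2 f2) (sub_nonneg.2 hord_Dp00)) (by positivity : (0:R) ≤ bu)
  have H35 := mul_nonneg (mul_nonneg (sub_nonneg.2 f7) (sub_nonneg.2 hord_Dp00)) (by positivity : (0:R) ≤ r₀u)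
  have H36 := mul_nonneg (mul_nonneg (sub_nonneg.2 f7) (sub_nonneg.2 hord_Dp01)) (by positivity : (0:R) ≤ r₀u)
  have H37 := mul_nonneg (mul_nonneg (sub_nonneg.2 f7) (sub_nonneg.2 hord_Dp01)) (by positivity : (0:R) ≤ bu)
  have H38 := mul_nonneg (mul_nonneg (sub_nonneg.2 f11) (sub_nonneg.2 hord_Dp00)) (by positivity : (0:R) ≤ a₁)
  have H39 := mul_nonneg (mul_nonneg (sub_nonneg.2 f11) (sub_nonneg.2 hord_Dp01)) (by positivity : (0:R) ≤ r₁u)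
  have H40 := mul_nonneg (mul_nonneg (sub_nonneg.2 f12) (sub_nonneg.2 hord_Dp01)) (by positivity : (0:R) ≤ o)
  have H41 := mul_nonneg (mul_nonneg (sub_nonneg.2 f12) (sub_nonneg.2 hord_Dp01)) (by positivity : (0:R) ≤ a₀)
  have H42 := mul_nonneg (mul_nonneg (sub_nonneg.2 f10) (sub_nonneg.2 hord_Dp01)) (by positivity : (0:R) ≤ o)
  have H43 := mul_nonneg (mul_nonneg (sub_nonneg.2 f10) (sub_nonneg.2 hord_Dp01)) (by positivity : (0:R) ≤ a₀)
  have H44 := mul_nonneg (mul_nonneg (sub_nonneg.2 f10) (sub_nonneg.2 hord_I0)) (by positivity : (0:R) ≤ r₁u)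
  have H45 := mul_nonneg (mul_nonneg (by positivity : (0:R) ≤ a₁) (by positivity : (0:R) ≤ a₀u)) (by positivity : (0:R) ≤ bu ^ 2)
  exact add_nonneg (add_nonneg (add_nonneg (add_nonneg (add_nonneg (add_nonneg (add_nonneg (add_nonneg (add_nonneg (add_nonneg (add_nonneg (add_nonneg (add_nonneg (add_nonneg (add_nonneg (add_nonneg (add_nonneg (add_nonneg (add_nonneg (add_nonneg (add_nonneg (add_nonneg (add_nonneg (add_nonneg (add_nonneg (add_nonneg (add_nonneg (add_nonneg (add_nonneg (add_nonneg (add_nonneg (add_nonneg (add_nonneg (add_nonneg (add_nonneg (add_nonneg (add_nonneg (add_nonneg (add_nonneg (add_nonneg (add_nonneg (add_nonneg (add_nonneg (add_nonneg (add_nonneg (H0) (H1)) (H2)) (H3)) (mul_nonneg (by norm_num : (0:R) ≤ 2) H4)) (mul_nonneg (by norm_num : (0:R) ≤ 2) H5)) (mul_nonneg (by norm_num : (0:R) ≤ 2) H6)) (H7)) (mul_nonneg (by norm_num : (0:R) ≤ 2) H8)) (mul_nonneg (by norm_num : (0:R) ≤ 2) H9)) (H10)) (H11)) (H12)) (mul_nonneg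 (by norm_num : (0:R) ≤ 2) H13)) (H14)) (H15)) (H16)) (mul_nonneg (by norm_num : (0:R) ≤ 2) H17)) (H18)) (H19)) (mul_nonneg (by norm_num : (0:R) ≤ 2) H20)) (H21)) (H22)) (H23)) (H24)) (mul_nonneg (by norm_num : (0:R) ≤ 2) H25)) (H26)) (H27)) (H28)) (H29)) (mul_nonneg (by norm_num : (0:R) ≤ 2) H30)) (H31)) (H32)) (H33)) (H34)) (H35)) (H36)) (H37)) (H38)) (H39)) (H40)) (H41)) (H42)) (H43)) (H44)) (H45)

set_option maxHeartbeats 1600000 in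
/-- **THE CERTIFICATE** for the gate `d' = d·1[j ∈ W]` on the six-cell sub-case: 46 products with
integer coefficients of 13 set-level Ahlswede–Daykin slacks (hypotheses `f0` … `f12`), the cellwise
order slacks `d ≤ c` and monomials (found by LP, kit j307364; exact in Fractions; the identity is checked in chunks). -/
theorem xa_six_gateJGen_cert (o a₀ a₁ b r₀ r₁ ou a₀u a₁u bu r₀u r₁u : R)
    (ho : 0 ≤ o) (ha₀ : 0 ≤ a₀) (ha₁ : 0 ≤ a₁) (hb : 0 ≤ b) (hr₀ : 0 ≤ r₀) (hr₁ : 0 ≤ r₁) (hou : 0 ≤ ou) (ha₀u : 0 ≤ a₀u) (ha₁u : 0 ≤ a₁u) (hbu : 0 ≤ bu) (hr₀u : 0 ≤ r₀u) (hr₁u : 0 ≤ r₁u)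
    (hord_Dp00 : a₀u ≤ a₀) (hord_Dp01 : a₁u ≤ a₁) (hord_Dpp10 : bu ≤ b) (hord_Dst10 : r₀u ≤ r₀) (hord_Dst11 : r₁u ≤ r₁) (hord_I0 : ou ≤ o)
    (f0 : a₀ * a₀ ≤ (a₀ + (o)) * a₀)
    (f1 : a₁ * bu ≤ o * r₁u)
    (f2 : a₁ * r₀u ≤ (a₀ + (o)) * r₁u)
    (f3 : r₀u * r₁u ≤ (bu + (r₀u)) * r₁u)
    (f4 : a₀ * a₁ ≤ (a₀ + (o)) * a₁)
    (f5 : a₀ * r₁u ≤ (a₀ + (o)) * r₁u)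
    (f6 : a₀ * r₀u ≤ (a₀ + (o)) * r₀u)
    (f7 : a₁ * (bu + (r₀u)) ≤ (a₀ + (o)) * r₁u)
    (f8 : a₁u * (bu + (r₀u)) ≤ (a₀u + (ou)) * r₁u)
    (f9 : (r₁ + (o)) * (a₀ + (a₁ + (o))) ≤ (a₀ + (a₁ + (o))) * (a₀ + (a₁ + (r₁ + (o)))))
    (f10 : (r₁u + (ou)) * (bu + (r₀u + (r₁u))) ≤ (bu + (r₀u + (r₁u + (ou)))) * (bu + (r₀u + (r₁u))))
    (f11 : (a₁ + (b)) * (bu + (r₀u + (r₁u))) ≤ (a₀ + (a₁ + (b + (o)))) * (bu + (r₀u + (r₁u))))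
    (f12 : (a₁u + (r₀u)) * (a₀ + (a₁ + (o))) ≤ (a₀ + (a₁ + (o))) * (a₁u + (r₀u + (r₁u)))) :
    ((o + a₀ + a₁ + bu + r₀u + r₁u) * (bu + r₀u + r₁u) - (bu + r₀u + r₁u) * (o + a₀u + a₁u + bu + r₀u + r₁u)) * ((o + a₀ + a₁ + bu + r₀u + r₁u) * (a₁ + r₁u) - (a₁ + r₁u) * (o + a₀ + a₁ + 0 + 0 + r₁u))
    + ((o + a₀ + a₁ + bu + r₀u + r₁u) * (a₁u + r₁u) - (a₁ + r₁u) * (o + a₀u + a₁u + bu + r₀u + r₁u)) * ((o + a₀ + a₁ + bu + r₀u + r₁u) * (0 + 0 + r₁u) - (bu + r₀u + r₁u) * (o + a₀ + a₁ + 0 + 0 + r₁u))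
    ≤ (o + a₀ + a₁ + bu + r₀u + r₁u) * ((o + a₀ + a₁ + bu + r₀u + r₁u) * (o + a₀ + a₁ + bu + r₀u + r₁u) * (r₁u) - (o + a₀ + a₁ + bu + r₀u + r₁u) * (a₁ + r₁u) * (0 + 0 + r₁u) - (o + a₀ + a₁ + bu + r₀u + r₁u) * (bu + r₀u + r₁u) * (a₁u + r₁u) + (bu + r₀u + r₁u) * (a₁ + r₁u) * (o + 0 + a₁u + 0 + 0 + r₁u)) := by
  rw [← sub_nonneg, xa_six_gateJGen_ET o a₀ a₁ b r₀ r₁ ou a₀u a₁u bu r₀u r₁u]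
  exact xa_six_gateJGen_S o a₀ a₁ b r₀ r₁ ou a₀u a₁u bu r₀u r₁u ho ha₀ ha₁ hb hr₀ hr₁ hou ha₀u ha₁u hbu hr₀u hr₁u hord_Dp00 hord_Dp01 hord_Dpp10 hord_Dst10 hord_Dst11 hord_I0 f0 f1 f2 f3 f4 f5 f6 f7 f8 f9 f10 f11 f12

end SixGateCert

end Summit.Ventures.PercRepro2.Coin
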